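import Literature.Topology.FourManifolds.RotationBody
import Literature.Topology.FourManifolds.OrientedConnectedSumExistence
import Literature.Topology.FourManifolds.GluingUniqueness
import Literature.Topology.FourManifolds.HomotopySpheresBP
import Literature.Topology.FourManifolds.CorkDecompositionSplittingProof
import HarnessLib

/-!
# The boundary of Kervaire–Milnor's rotation body is `M # (-M)` (proof of Lemma 2.4, continued)

Topic `Literature/Topology/FourManifolds`, continuation of `RotationBody.lean`. Kervaire–Milnor,
*Groups of homotopy spheres I*, Ann. of Math. 77 (1963), proof of Lemma 2.4 (p. 507): the rotation
body `W = (M - i(½D̊ⁿ)) × [0, π] ∪_ψ Sⁿ⁻¹ × H²` "is a differentiable manifold with `bW = M # (-M)`".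

Here `M # (-M)` is the connected sum of `M` with itself formed with the *same* disc `i` on both
sides, i.e. the glued manifold `P₀ = (M ∖ {i 0}) ∪_φ (M ∖ {i 0})` of the connected sum data
`(e, e)` (`RotationData.csd`, tree construction `ConnectedSumData.Glued`), and this file proves
that `P₀` is diffeomorphic to the boundary `∂W` (with the tree's smooth structure on the boundary
of a manifold with boundary, `BoundaryManifold.chartedSpace`):

* `RotationData.bdryMap s : M ∖ {i 0} → W` (`s = 0, 1`): `x ↦ (x, s)` on `M ∖ i(B̄(0, ½))`
  (the face `s` of the cylinder) and `i(v) ↦ (v/‖v‖, (2‖v‖ - 1)(sin πs, cos πs))` on the punctured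
  unit disc (the half `z₁ > 0`, resp. `z₁ < 0`, of the diameter of the half-disc bundle) — the two
  formulas agree on `½ < ‖v‖ < 1` by the very definition of the gluing `ψ`;
* `RotationData.toBoundary : P₀ → ∂W`, induced (`SmoothGlueData.lift`, the universal property of
  the glued space, `CorkDecompositionSplittingProof.lean`) by `bdryMap 0` and `bdryMap 1`, which are
  compatible with the connected-sum identification `i(tu) ∼ i((1 - t)u)` (the point `i(tu)`, seen
  from the other side, is `i((1 - t)u)`, and `2t - 1 = -(2(1 - t) - 1)`);
* `RotationData.ofBoundary : ∂W → P₀`, the inverse, `(x, 0) ↦ [x]₁`, `(x, 1) ↦ [x]₂`,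
  `(w, (0, b)) ↦ [i(((1 + b)/2) w)]₁`;
* `RotationData.boundaryDiffeo : P₀ ≃ₘ ∂W` (smoothness of both maps is local: descent along the
  open immersions `inl`, `inr` of the two gluings, `contMDiffAt_of_comp_isImmersionAt`);
* `RotationData.nullCobordism : NullCobordism (m + 1) P₀` with total space `W`
  (`NullCobordism.comap` of `∂W = ∂W` along the diffeomorphism): **`M # (-M)` bounds `W`**.

## References

* M. Kervaire, J. Milnor, *Groups of homotopy spheres I*, Ann. of Math. (2) 77 (1963), 504–537,
  proof of Lemma 2.4 (p. 507). [KervaireMilnorAnnals1963]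
* A. Kosinski, *Differential Manifolds*, Academic Press (1993), Ch. VI §1. [Kosinski1993]
-/

open scoped Manifold ContDiff Topology
open Set Function Metric Real

noncomputable section

universe u

namespace Literature.Topology.FourManifolds

/-- Local notation: `𝔼 n` is the model Euclidean space `EuclideanSpace ℝ (Fin n)`. -/
local notation "𝔼 " n:arg => EuclideanSpace ℝ (Fin n)
/-- Local notation: `ℍ n` is the model half-space `EuclideanHalfSpace n`. -/
local notation "ℍ " n:arg => EuclideanHalfSpace n
/-- Local notation: `𝕊 m` is the unit sphere in `EuclideanSpace ℝ (Fin (m + 1))`. -/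
local notation "𝕊 " m:arg => (Metric.sphere (0 : EuclideanSpace ℝ (Fin (m + 1))) 1)

namespace RotationBody

variable {m : ℕ}

attribute [local instance] Classical.propDecidable

/-- The disc coordinate `(2‖v‖ - 1) • rot s` of the boundary map on the punctured unit disc,
extended by `0`. [cite: KervaireMilnorAnnals1963, Lemma 2.4, proof (p. 507)] -/
def dV (s : ℝ) (v : 𝔼 (m + 1)) : 𝔼 2 :=
  if 0 < ‖v‖ ∧ ‖v‖ < 1 then (2 * ‖v‖ - 1) • rot s else 0

/-- On the punctured unit disc the disc coordinate is `(2‖v‖ - 1) • rot s`. [folklore] -/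
theorem dV_of_mem {s : ℝ} {v : 𝔼 (m + 1)} (hv : 0 < ‖v‖ ∧ ‖v‖ < 1) :
    dV s v = (2 * ‖v‖ - 1) • rot s := if_pos hv

/-- The disc coordinate has norm `< 1`. [folklore] -/
theorem norm_dV_lt (s : ℝ) (v : 𝔼 (m + 1)) : ‖dV s v‖ < 1 := by
  by_cases hv : 0 < ‖v‖ ∧ ‖v‖ < 1
  · rw [dV_of_mem hv, norm_smul, norm_rot, mul_one, Real.norm_eq_abs, abs_lt]
    constructor <;> linarith [hv.1, hv.2]
  · rw [dV, if_neg hv, norm_zero]; exact one_pos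

/-- The first component of the disc coordinate. [folklore] -/
theorem dV_apply_zero (s : ℝ) (v : 𝔼 (m + 1)) : dV s v 0 = (if 0 < ‖v‖ ∧ ‖v‖ < 1 then
    (2 * ‖v‖ - 1) * Real.sin (π * s) else 0) := by
  by_cases hv : 0 < ‖v‖ ∧ ‖v‖ < 1
  · rw [dV_of_mem hv, if_pos hv, PiLp.smul_apply, smul_eq_mul, rot_apply_zero]
  · rw [dV, if_neg hv, if_neg hv]; rfl

/-- For `s ∈ {0, 1}` the disc coordinate lies on the diameter `z₀ = 0`. [folklore] -/
theorem dV_apply_zero_of_boundary {s : ℝ} (hs : s = 0 ∨ s = 1) (v : 𝔼 (m + 1)) : dV s v 0 = 0 := by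
  rw [dV_apply_zero]
  by_cases hv : 0 < ‖v‖ ∧ ‖v‖ < 1
  · rw [if_pos hv]
    rcases hs with rfl | rfl <;> simp
  · rw [if_neg hv]

/-- A face parameter `s ∈ {0, 1}` lies in `[0, 1]`. [folklore] -/
theorem mem_Icc_of_face {s : ℝ} (hs : s = 0 ∨ s = 1) : s ∈ Icc (0 : ℝ) 1 := by
  rcases hs with rfl | rfl
  · exact ⟨le_rfl, zero_le_one⟩
  · exact ⟨zero_le_one, le_rfl⟩

/-- The point `(v/‖v‖, (2‖v‖ - 1) • rot s)` of the diameter of the second piece over a point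
`i(v)` of the punctured unit disc, for a face parameter `s ∈ {0, 1}` (junk values elsewhere). [cite: KervaireMilnorAnnals1963, Lemma 2.4, proof (p. 507)] -/
def diamB (s : ℝ) (hs : s = 0 ∨ s = 1) (v : 𝔼 (m + 1)) : B m :=
  mkB (sphN v) (dV s v) (norm_dV_lt s v) (by rw [dV_apply_zero_of_boundary hs])

/-- The sphere coordinate of the diameter point is `v/‖v‖`. [folklore] -/
@[simp] theorem diamB_coe_fst (s : ℝ) (hs : s = 0 ∨ s = 1) (v : 𝔼 (m + 1)) :
    (diamB s hs v).1.1 = sphN v := rfl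

/-- The disc coordinate of the diameter point is `dV s v`. [folklore] -/
@[simp] theorem diamB_coe_snd (s : ℝ) (hs : s = 0 ∨ s = 1) (v : 𝔼 (m + 1)) :
    ((diamB s hs v).1.2 : 𝔼 2) = dV s v := rfl

/-- `0` is a face parameter. [folklore] -/
theorem face_zero : (0 : ℝ) = 0 ∨ (0 : ℝ) = 1 := Or.inl rfl

/-- `1` is a face parameter. [folklore] -/
theorem face_one : (1 : ℝ) = 0 ∨ (1 : ℝ) = 1 := Or.inr rfl

/-- `c • rot 1 = (-c) • rot 0` (`rot 1 = -rot 0`). [folklore] -/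
theorem smul_rot_one (c : ℝ) : c • rot 1 = (-c) • rot 0 := by
  rw [rot_one, rot_zero]
  ext j
  fin_cases j <;> simp [E2]

end RotationBody

namespace RotationData

open RotationBody

variable {m : ℕ} {M : Type u} [TopologicalSpace M] [ChartedSpace (𝔼 (m + 1)) M] [T2Space M]
  [IsManifold (𝓡 (m + 1)) ∞ M] (R : RotationData m M)

attribute [local instance] Classical.propDecidable

/-! ### The connected sum `M # (-M)` formed with the disc `i` on both sides -/

/-- `m + 1 ≠ 0` (the dimension hypothesis of the connected sum construction). [folklore] -/
theorem hn : m + 1 ≠ 0 := m.succ_ne_zero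

/-- **The double `P₀ = M # (-M)`** formed with the disc `i` on both sides: the glued manifold of the
connected sum data `(e, e)` (tree construction `ConnectedSumData.Glued`), a smooth
`(m+1)`-manifold. [cite: KervaireMilnorAnnals1963, Lemma 2.4, proof (p. 507)] -/
abbrev P₀ : Type u := R.csd.Glued hn

/-- The punctured manifold `M ∖ {i 0}`, both pieces of `P₀`. [folklore] -/
abbrev Mpunct : TopologicalSpace.Opens M := puncture R.i

/-- The first copy `M ∖ {i 0} → P₀`. [folklore] -/
abbrev inlP : ↥R.Mpunct → R.P₀ := (R.csd.glueData hn).inl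

/-- The second copy `M ∖ {i 0} → P₀`. [folklore] -/
abbrev inrP : ↥R.Mpunct → R.P₀ := (R.csd.glueData hn).inr

omit [IsManifold (𝓡 (m + 1)) ∞ M] in
/-- The centre `i 0` lies in `i(B̄(0, ½))`, hence not in `M'`. [folklore] -/
theorem i_zero_not_mem_M' : R.i 0 ∉ R.M' := fun h =>
  h ⟨0, by simp, rfl⟩

omit [IsManifold (𝓡 (m + 1)) ∞ M] in
/-- A point of `M'` is not the centre. [folklore] -/
theorem ne_center_of_mem_M' {x : M} (hx : x ∈ R.M') : x ≠ R.i 0 := fun h =>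
  R.i_zero_not_mem_M' (h ▸ hx)

omit [IsManifold (𝓡 (m + 1)) ∞ M] in
/-- `M' ≤ M ∖ {i 0}` as open subsets. [folklore] -/
theorem M'_le_Mpunct : R.M' ≤ R.Mpunct := fun _ hx => R.ne_center_of_mem_M' hx

/-- The inclusion `M' → M ∖ {i 0}`. [folklore] -/
def toPunct (x : R.M') : ↥R.Mpunct := TopologicalSpace.Opens.inclusion R.M'_le_Mpunct x

omit [IsManifold (𝓡 (m + 1)) ∞ M] in
/-- The inclusion `M' → M ∖ {i 0}` on underlying points (definitional). [folklore] -/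
@[simp] theorem coe_toPunct (x : R.M') : (R.toPunct x : M) = x := rfl

omit [IsManifold (𝓡 (m + 1)) ∞ M] in
/-- The inclusion `M' → M ∖ {i 0}` is smooth. [folklore] -/
theorem contMDiff_toPunct : ContMDiff (𝓡 (m + 1)) (𝓡 (m + 1)) ∞ R.toPunct :=
  contMDiff_inclusion R.M'_le_Mpunct

omit [T2Space M] [IsManifold (𝓡 (m + 1)) ∞ M] in
/-- A point of the coordinate patch other than the centre has nonzero coordinate. [folklore] -/
theorem e_ne_zero_of_ne_center {x : M} (hx : x ∈ R.e.source) (h : x ≠ R.i 0) : R.e x ≠ 0 :=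
  fun h0 => h (by rw [← R.i_e hx, h0])

omit [IsManifold (𝓡 (m + 1)) ∞ M] in
/-- **The gluing relation of `P₀` is Kervaire–Milnor's connected sum relation**:
`[a]₁ = [b]₂ ↔ a = i(tu), b = i((1 - t)u)` for a unit vector `u` and `0 < t < 1`.
[cite: KervaireMilnorAnnals1963, §2 p. 505] -/
theorem inlP_eq_inrP_iff (a b : ↥R.Mpunct) :
    R.inlP a = R.inrP b ↔ connectedSumRel R.i R.i a b :=
  (R.csd.glueData hn).inl_eq_inr_iff.trans (R.csd.connectedSumRel_iff_φ hn a b).symm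

omit [IsManifold (𝓡 (m + 1)) ∞ M] in
/-- `[i(tu)]₁ = [i((1 - t)u)]₂` in `P₀` for a unit vector `u` and `0 < t < 1`. [cite: KervaireMilnorAnnals1963, §2 p. 505] -/
theorem inlP_eq_inrP {u : 𝔼 (m + 1)} (hu : ‖u‖ = 1) {t : ℝ} (ht : t ∈ Ioo (0 : ℝ) 1)
    (ha : R.i (t • u) ∈ R.Mpunct) (hb : R.i ((1 - t) • u) ∈ R.Mpunct) :
    R.inlP ⟨R.i (t • u), ha⟩ = R.inrP ⟨R.i ((1 - t) • u), hb⟩ :=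
  (R.inlP_eq_inrP_iff _ _).2 ⟨u, t, hu, ht, rfl, rfl⟩

/-! ### The boundary maps `M ∖ {i 0} → W` -/

/-- The `M'`-point under a point of `M ∖ {i 0}` (junk value `x₀` on `i(B̄(0, ½))`). [folklore] -/
def faceM' (a : ↥R.Mpunct) : R.M' := if h : (a : M) ∈ R.M' then ⟨a, h⟩ else R.x₀

omit [IsManifold (𝓡 (m + 1)) ∞ M] in
/-- On `M'` the `M'`-point is the point itself. [folklore] -/
theorem faceM'_of_mem {a : ↥R.Mpunct} (h : (a : M) ∈ R.M') : R.faceM' a = ⟨a, h⟩ := dif_pos h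

/-- The open subset of `M ∖ {i 0}` over the open unit disc. [folklore] -/
def discSet : Set ↥R.Mpunct := {a | (a : M) ∈ R.e.source ∧ ‖R.e a‖ < 1}

omit [IsManifold (𝓡 (m + 1)) ∞ M] in
/-- Membership in the disc part: `a ∈ e.source` and `‖e a‖ < 1`. [folklore] -/
theorem mem_discSet_iff {a : ↥R.Mpunct} : a ∈ R.discSet ↔ (a : M) ∈ R.e.source ∧ ‖R.e a‖ < 1 :=
  Iff.rfl

omit [IsManifold (𝓡 (m + 1)) ∞ M] in
/-- The disc part is open. [folklore] -/
theorem isOpen_discSet : IsOpen R.discSet := by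
  have h := R.e.isOpen_inter_preimage (isOpen_ball (x := (0 : 𝔼 (m + 1))) (ε := 1))
  convert h.preimage continuous_subtype_val using 1
  ext a; simp [discSet]

omit [IsManifold (𝓡 (m + 1)) ∞ M] in
/-- On the disc part, `0 < ‖e a‖ < 1` (the centre is removed). [folklore] -/
theorem norm_mem_of_mem_discSet {a : ↥R.Mpunct} (ha : a ∈ R.discSet) :
    0 < ‖R.e a‖ ∧ ‖R.e a‖ < 1 :=
  ⟨norm_pos_iff.2 (R.e_ne_zero_of_ne_center ha.1 a.2), ha.2⟩

omit [IsManifold (𝓡 (m + 1)) ∞ M] in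
/-- Off the open unit disc, a point of `M ∖ {i 0}` lies in `M'`. [folklore] -/
theorem mem_M'_of_not_mem_discSet {a : ↥R.Mpunct} (ha : a ∉ R.discSet) : (a : M) ∈ R.M' := by
  by_cases hs : (a : M) ∈ R.e.source
  · rw [R.mem_M'_iff_of_mem_source hs]
    have : ¬ ‖R.e a‖ < 1 := fun h => ha ⟨hs, h⟩
    linarith [not_lt.1 this]
  · exact R.mem_M'_of_not_mem_source hs

/-- **The boundary map** `M ∖ {i 0} → W` at the face `s` (`s = 0`: the copy `M × 0`, `s = 1`: the
copy `M × π` of Kervaire–Milnor): `x ↦ inl (x, s)` off the unit disc and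
`i(v) ↦ inr (v/‖v‖, (2‖v‖ - 1) rot s)` on the punctured unit disc. [cite: KervaireMilnorAnnals1963, Lemma 2.4, proof (p. 507)] -/
def bdryMap (s : ℝ) (hs : s = 0 ∨ s = 1) (a : ↥R.Mpunct) : R.W :=
  if a ∈ R.discSet then R.glueData.inr (diamB s hs (R.e a))
  else R.glueData.inl (R.mkA (R.faceM' a) s (mem_Icc_of_face hs))

/-- On the punctured unit disc the boundary map is the diameter formula. [folklore] -/
theorem bdryMap_of_mem_discSet {s : ℝ} {hs : s = 0 ∨ s = 1} {a : ↥R.Mpunct} (ha : a ∈ R.discSet) :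
    R.bdryMap s hs a = R.glueData.inr (diamB s hs (R.e a)) := if_pos ha

omit [IsManifold (𝓡 (m + 1)) ∞ M] in
/-- On the overlap `i({½ < ‖v‖ < 1})` the gluing map of `W` takes `(x, s)` to the diameter point
`(v/‖v‖, (2‖v‖ - 1) rot s)`, `v = e x`. [folklore] -/
theorem glueFun_mkA {s : ℝ} (hs : s = 0 ∨ s = 1) {x : R.M'} (hx : (x : M) ∈ R.e.source)
    (hx1 : ‖R.e x‖ < 1) :
    R.glueFun (R.mkA x s (mem_Icc_of_face hs)) = diamB s hs (R.e x) := by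
  have ha : R.mkA x s (mem_Icc_of_face hs) ∈ R.glueSource := ⟨hx, hx1⟩
  -- (the norm bounds are re-derived at `x` itself: unfolding them through `mkA` is expensive)
  have h0 : 0 < ‖R.e (x : M)‖ := lt_trans (by norm_num) ((R.mem_M'_iff_of_mem_source hx).1 x.2)
  have hv : 0 < ‖R.e x‖ ∧ ‖R.e x‖ < 1 := ⟨h0, hx1⟩
  have h1 : R.glueSph (R.mkA x s (mem_Icc_of_face hs)) = sphN (R.e x) := rfl
  have e1 : R.glueVec (R.mkA x s (mem_Icc_of_face hs)) = (2 * ‖R.e x‖ - 1) • rot s :=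
    R.glueVec_of_mem ha
  have e2 : dV s (R.e x) = (2 * ‖R.e x‖ - 1) • rot s := dV_of_mem hv
  have h2 : R.glueVec (R.mkA x s (mem_Icc_of_face hs)) = dV s (R.e x) := e1.trans e2.symm
  apply Subtype.ext
  apply Prod.ext
  · exact h1
  · exact Subtype.ext h2

/-- **The two formulas of the boundary map agree on the overlap** `i({½ < ‖v‖ < 1})`: there
`inl (i v, s) = inr (v/‖v‖, (2‖v‖ - 1) rot s)` is the gluing identification of `W`. [cite: KervaireMilnorAnnals1963, Lemma 2.4, proof (p. 507)] -/
theorem inl_mkA_eq_inr_diamB {s : ℝ} (hs : s = 0 ∨ s = 1) {x : R.M'} (hx : (x : M) ∈ R.e.source)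
    (hx1 : ‖R.e x‖ < 1) :
    R.glueData.inl (R.mkA x s (mem_Icc_of_face hs)) = R.glueData.inr (diamB s hs (R.e x)) := by
  have ha : R.mkA x s (mem_Icc_of_face hs) ∈ R.glueData.glue.source := ⟨hx, hx1⟩
  rw [← R.glueData.inr_glue ha, glueData_glue, glue_apply, R.glueFun_mkA hs hx hx1]

/-- On `M'` the boundary map is the face formula `x ↦ inl (x, s)`. [folklore] -/
theorem bdryMap_of_mem_M' {s : ℝ} {hs : s = 0 ∨ s = 1} {a : ↥R.Mpunct} (ha : (a : M) ∈ R.M') :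
    R.bdryMap s hs a = R.glueData.inl (R.mkA ⟨a, ha⟩ s (mem_Icc_of_face hs)) := by
  by_cases hd : a ∈ R.discSet
  · -- (the hypotheses are restated at the point `⟨a, ha⟩ : M'`: inferring it by unification
    -- through the coercions of two different subtypes is prohibitively slow)
    have hx' : ((⟨a, ha⟩ : R.M') : M) ∈ R.e.source := hd.1
    have hx1' : ‖R.e ((⟨a, ha⟩ : R.M') : M)‖ < 1 := hd.2
    rw [R.bdryMap_of_mem_discSet hd, R.inl_mkA_eq_inr_diamB hs hx' hx1']
  · rw [bdryMap, if_neg hd, R.faceM'_of_mem ha]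

/-- The boundary map takes values in the boundary of `W` when `s ∈ {0, 1}`. [folklore] -/
theorem bdryMap_mem_boundary {s : ℝ} (hs : s = 0 ∨ s = 1) (a : ↥R.Mpunct) :
    R.bdryMap s hs a ∈ (𝓡∂ (m + 2)).boundary R.W := by
  by_cases hd : a ∈ R.discSet
  · rw [R.bdryMap_of_mem_discSet hd]
    show (𝓡∂ (m + 2)).IsBoundaryPoint _
    rw [R.isBoundaryPoint_inr_iff, diamB_coe_snd]
    exact dV_apply_zero_of_boundary hs _
  · rw [bdryMap, if_neg hd]
    show (𝓡∂ (m + 2)).IsBoundaryPoint _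
    rw [R.isBoundaryPoint_inl_iff]
    exact hs

/-! #### Smoothness of the boundary maps -/

omit [IsManifold (𝓡 (m + 1)) ∞ M] in
/-- The coordinate `a ↦ e a` is smooth on the disc part of `M ∖ {i 0}`. [folklore] -/
theorem contMDiffOn_e_punct :
    ContMDiffOn (𝓡 (m + 1)) 𝓘(ℝ, 𝔼 (m + 1)) ∞ (fun a : ↥R.Mpunct => R.e a) R.discSet :=
  R.contMDiffOn_e.comp contMDiff_subtype_val.contMDiffOn fun _ ha => ha.1

omit [IsManifold (𝓡 (m + 1)) ∞ M] in
/-- The diameter formula is smooth on the disc part (read in `Sᵐ × D`, product model). [folklore] -/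
theorem contMDiffOn_val_diamB (s : ℝ) (hs : s = 0 ∨ s = 1) :
    ContMDiffOn (𝓡 (m + 1)) ((𝓡 m).prod (𝓡 2)) ∞
      (fun a : ↥R.Mpunct => (diamB s hs (R.e a)).1) R.discSet := by
  refine ContMDiffOn.prodMk ?_ fun a ha => ?_
  · exact contMDiffOn_sphN.comp R.contMDiffOn_e_punct fun a ha =>
      R.e_ne_zero_of_ne_center ha.1 a.2
  · rw [← ContMDiffWithinAt.subtypeVal_comp_iff]
    show ContMDiffWithinAt (𝓡 (m + 1)) 𝓘(ℝ, 𝔼 2) ∞ (fun a : ↥R.Mpunct => dV s (R.e a)) R.discSet a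
    have h1 : ContMDiffOn (𝓡 (m + 1)) 𝓘(ℝ, 𝔼 (m + 1) × ℝ) ∞
        (fun a : ↥R.Mpunct => (R.e a, s)) R.discSet :=
      R.contMDiffOn_e_punct.prodMk_space contMDiffOn_const
    have h2 : ContMDiffOn (𝓡 (m + 1)) 𝓘(ℝ, 𝔼 2) ∞
        (fun a : ↥R.Mpunct => (2 * ‖R.e a‖ - 1) • rot s) R.discSet := fun a ha =>
      (contDiffAt_radius_smul_rot (q := (R.e a, s))
        (R.e_ne_zero_of_ne_center ha.1 a.2)).comp_contMDiffWithinAt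
          (f := fun a : ↥R.Mpunct => (R.e a, s)) (x := a) (h1 a ha)
    exact (h2.congr fun a ha => dV_of_mem (R.norm_mem_of_mem_discSet ha)) a ha

omit [IsManifold (𝓡 (m + 1)) ∞ M] in
/-- The diameter formula is smooth on the disc part, as a map into the second piece. [folklore] -/
theorem contMDiffOn_diamB (s : ℝ) (hs : s = 0 ∨ s = 1) :
    ContMDiffOn (𝓡 (m + 1)) (𝓡∂ (m + 2)) ∞ (fun a : ↥R.Mpunct => diamB s hs (R.e a)) R.discSet := by
  have h : ContMDiffOn (𝓡 (m + 1)) (HalfDiscBundle.model m) ∞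
      (fun a : ↥R.Mpunct => (diamB s hs (R.e a)).1) R.discSet := by
    rw [HalfDiscBundle.model, ContinuousLinearEquiv.contMDiffOn_transContinuousLinearEquiv_right]
    exact R.contMDiffOn_val_diamB s hs
  exact (HalfDiscBundle.atlas m).contMDiffOn_codRestrict (g := fun a : ↥R.Mpunct => (diamB s hs (R.e a)).1)
    (fun a => (diamB s hs (R.e a)).2) R.isOpen_discSet h

omit [IsManifold (𝓡 (m + 1)) ∞ M] in
/-- The face formula is smooth on `M'` (read in `M' × ℝ`, product model). [folklore] -/
theorem contMDiffOn_val_mkA_faceM' (s : ℝ) (hs : s = 0 ∨ s = 1) :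
    ContMDiffOn (𝓡 (m + 1)) ((𝓡 (m + 1)).prod 𝓘(ℝ, ℝ)) ∞
      (fun a : ↥R.Mpunct => (R.mkA (R.faceM' a) s (mem_Icc_of_face hs)).1) {a | (a : M) ∈ R.M'} := by
  refine ContMDiffOn.prodMk (fun a ha => ?_) contMDiffOn_const
  rw [← ContMDiffWithinAt.subtypeVal_comp_iff]
  have h : ContMDiffOn (𝓡 (m + 1)) (𝓡 (m + 1)) ∞ (fun a : ↥R.Mpunct => (a : M)) {a | (a : M) ∈ R.M'} :=
    contMDiff_subtype_val.contMDiffOn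
  refine (h a ha).congr (fun a' ha' => ?_) ?_
  · show ((R.faceM' a' : R.M') : M) = a'
    rw [R.faceM'_of_mem ha']
  · show ((R.faceM' a : R.M') : M) = a
    rw [R.faceM'_of_mem ha]

omit [IsManifold (𝓡 (m + 1)) ∞ M] in
/-- The set of points of `M ∖ {i 0}` over `M'` is open. [folklore] -/
theorem isOpen_M'Set : IsOpen {a : ↥R.Mpunct | (a : M) ∈ R.M'} :=
  R.M'.isOpen.preimage continuous_subtype_val

/-- The face formula is smooth on `M'`, as a map into the first piece. [folklore] -/
theorem contMDiffOn_mkA_faceM' (s : ℝ) (hs : s = 0 ∨ s = 1) :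
    ContMDiffOn (𝓡 (m + 1)) (𝓡∂ (m + 2)) ∞ (fun a : ↥R.Mpunct => R.mkA (R.faceM' a) s (mem_Icc_of_face hs))
      {a | (a : M) ∈ R.M'} := by
  have h : ContMDiffOn (𝓡 (m + 1)) (Cylinder.model (m + 1)) ∞
      (fun a : ↥R.Mpunct => (R.mkA (R.faceM' a) s (mem_Icc_of_face hs)).1) {a | (a : M) ∈ R.M'} := by
    rw [Cylinder.model, ContinuousLinearEquiv.contMDiffOn_transContinuousLinearEquiv_right]
    exact R.contMDiffOn_val_mkA_faceM' s hs
  exact (Cylinder.atlas (m + 1) (↥R.M')).contMDiffOn_codRestrict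
    (g := fun a : ↥R.Mpunct => (R.mkA (R.faceM' a) s (mem_Icc_of_face hs)).1)
    (fun a => (R.mkA (R.faceM' a) s (mem_Icc_of_face hs)).2) R.isOpen_M'Set h

/-- **The boundary map is smooth** (`M ∖ {i 0} → W`): on the open cover by the disc part and
the `M'`-part it is `inr ∘ (diameter formula)` and `inl ∘ (face formula)`. [folklore] -/
theorem contMDiff_bdryMap (s : ℝ) (hs : s = 0 ∨ s = 1) :
    ContMDiff (𝓡 (m + 1)) (𝓡∂ (m + 2)) ∞ (R.bdryMap s hs) := by
  intro a
  by_cases hd : a ∈ R.discSet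
  · have h : ContMDiffOn (𝓡 (m + 1)) (𝓡∂ (m + 2)) ∞
        (fun a : ↥R.Mpunct => R.glueData.inr (diamB s hs (R.e a))) R.discSet :=
      R.glueData.contMDiff_inrH.comp_contMDiffOn (R.contMDiffOn_diamB s hs)
    exact ((h.congr fun a' ha' => R.bdryMap_of_mem_discSet ha').contMDiffAt
      (R.isOpen_discSet.mem_nhds hd))
  · have hM : (a : M) ∈ R.M' := R.mem_M'_of_not_mem_discSet hd
    have h : ContMDiffOn (𝓡 (m + 1)) (𝓡∂ (m + 2)) ∞
        (fun a : ↥R.Mpunct => R.glueData.inl (R.mkA (R.faceM' a) s (mem_Icc_of_face hs))) {a | (a : M) ∈ R.M'} :=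
      R.glueData.contMDiff_inlH.comp_contMDiffOn (R.contMDiffOn_mkA_faceM' s hs)
    refine (h.congr fun a' ha' => ?_).contMDiffAt (R.isOpen_M'Set.mem_nhds hM)
    rw [R.bdryMap_of_mem_M' ha', R.faceM'_of_mem ha']

/-- The boundary map is continuous. [folklore] -/
theorem continuous_bdryMap (s : ℝ) (hs : s = 0 ∨ s = 1) : Continuous (R.bdryMap s hs) :=
  (R.contMDiff_bdryMap s hs).continuous

/-! ### The map `P₀ → ∂W` -/

/-- **The two boundary maps are compatible with the connected sum identification**:
for `a = i(v)`, `0 < ‖v‖ < 1`, glued in `P₀` to `b = i((1 - ‖v‖) v/‖v‖)`, one has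
`bdryMap 0 a = bdryMap 1 b` (both are `inr (v/‖v‖, (0, 2‖v‖ - 1))`). [cite: KervaireMilnorAnnals1963, Lemma 2.4, proof (p. 507)] -/
theorem bdryMap_compat (a : ↥R.Mpunct) (ha : a ∈ (R.csd.glueData hn).glue.source) :
    R.bdryMap 0 face_zero a = R.bdryMap 1 face_one ((R.csd.glueData hn).glue a) := by
  rw [ConnectedSumData.glueData_glue] at ha ⊢
  have ha' := (R.csd.mem_φ_source hn).1 ha
  rw [ConnectedSumData.mem_Φ_source, csd_e₁] at ha'
  obtain ⟨has, h0, h1⟩ := ha'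
  set v := R.e a with hv
  have hv0 : v ≠ 0 := norm_pos_iff.1 h0
  set b := R.csd.φ hn a with hb
  have hbM : (b : M) = R.i (discInversionFun v) := by
    rw [hb, R.csd.coe_φ hn ha, ConnectedSumData.Φ_apply]; rfl
  have hdn : ‖discInversionFun v‖ = 1 - ‖v‖ := norm_discInversionFun hv0 h1.le
  have hbs : (b : M) ∈ R.e.source := by rw [hbM]; exact R.i_mem _
  have heb : R.e b = discInversionFun v := by rw [hbM, R.e_i]
  have hadisc : a ∈ R.discSet := ⟨has, h1⟩
  have hbdisc : b ∈ R.discSet := ⟨hbs, by rw [heb, hdn]; linarith⟩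
  rw [R.bdryMap_of_mem_discSet hadisc, R.bdryMap_of_mem_discSet hbdisc]
  congr 1
  have hva : 0 < ‖v‖ ∧ ‖v‖ < 1 := ⟨h0, h1⟩
  have hvb : 0 < ‖discInversionFun v‖ ∧ ‖discInversionFun v‖ < 1 := by
    rw [hdn]; constructor <;> linarith
  have hc : 0 < (1 - ‖v‖) * ‖v‖⁻¹ := mul_pos (by linarith) (inv_pos.2 h0)
  apply Subtype.ext
  ext : 1
  · show sphN v = sphN (R.e b)
    rw [heb, discInversionFun, sphN_smul hc hv0]
  · apply Subtype.ext
    show dV 0 v = dV 1 (R.e b)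
    rw [heb, dV_of_mem hva, dV_of_mem hvb, hdn, smul_rot_one]
    congr 1
    ring

/-- **The map `P₀ → W`** induced by the two boundary maps. [cite: KervaireMilnorAnnals1963, Lemma 2.4, proof (p. 507)] -/
def toW : R.P₀ → R.W :=
  (R.csd.glueData hn).lift (R.bdryMap 0 face_zero) (R.bdryMap 1 face_one) R.bdryMap_compat

/-- The induced map on the first copy is `bdryMap 0`. [folklore] -/
@[simp] theorem toW_inlP (a : ↥R.Mpunct) : R.toW (R.inlP a) = R.bdryMap 0 face_zero a := rfl

/-- The induced map on the second copy is `bdryMap 1`. [folklore] -/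
@[simp] theorem toW_inrP (b : ↥R.Mpunct) : R.toW (R.inrP b) = R.bdryMap 1 face_one b := rfl

/-- The induced map takes values in `∂W`. [folklore] -/
theorem toW_mem_boundary (p : R.P₀) : R.toW p ∈ (𝓡∂ (m + 2)).boundary R.W := by
  obtain ⟨a, rfl⟩ | ⟨b, rfl⟩ := (R.csd.glueData hn).exists_inl_or_inr p
  · exact R.bdryMap_mem_boundary face_zero a
  · exact R.bdryMap_mem_boundary face_one b

/-- **The induced map `P₀ → W` is smooth**: smoothness descends along the open immersions
`inl`, `inr` of `P₀` (`contMDiffAt_of_comp_isImmersionAt`). [folklore] -/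
theorem contMDiff_toW : ContMDiff (𝓡 (m + 1)) (𝓡∂ (m + 2)) ∞ R.toW := by
  intro p
  obtain ⟨a, rfl⟩ | ⟨b, rfl⟩ := (R.csd.glueData hn).exists_inl_or_inr p
  · exact contMDiffAt_of_comp_isImmersionAt
      ((R.csd.glueData hn).isSmoothEmbedding_inl.isImmersion.isImmersionAt a)
      (R.csd.glueData hn).isOpenMap_inl (R.contMDiff_bdryMap 0 _ a) fun a' => rfl
  · exact contMDiffAt_of_comp_isImmersionAt
      ((R.csd.glueData hn).isSmoothEmbedding_inr.isImmersion.isImmersionAt b)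
      (R.csd.glueData hn).isOpenMap_inr (R.contMDiff_bdryMap 1 _ b) fun b' => rfl

/-- The boundary `∂W` of the rotation body, a smooth `(m+1)`-manifold without boundary
(`BoundaryManifold.chartedSpace`). [folklore] -/
abbrev bdW : Type u := ↥((𝓡∂ (m + 2)).boundary R.W)

/-- **The map `P₀ → ∂W`.** [cite: KervaireMilnorAnnals1963, Lemma 2.4, proof (p. 507)] -/
def toBoundary : R.P₀ → R.bdW := Set.codRestrict R.toW _ R.toW_mem_boundary

/-- The underlying point of `toBoundary p` is `toW p`. [folklore] -/
@[simp] theorem coe_toBoundary (p : R.P₀) : (R.toBoundary p : R.W) = R.toW p := rfl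

/-- The map `P₀ → ∂W` is smooth (`BoundaryManifold.contMDiff_codRestrict`). [folklore] -/
theorem contMDiff_toBoundary : ContMDiff (𝓡 (m + 1)) (𝓡 (m + 1)) ∞ R.toBoundary :=
  BoundaryManifold.contMDiff_codRestrict R.toW_mem_boundary R.contMDiff_toW

/-! ### The inverse map `∂W → P₀` -/

/-- The point of `M ∖ {i 0}` under a point `(x, s)` of the first piece. [folklore] -/
def ptA (a : R.A) : ↥R.Mpunct := R.toPunct a.1.1

omit [IsManifold (𝓡 (m + 1)) ∞ M] in
/-- The underlying point of `ptA (x, s)` is `x`. [folklore] -/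
@[simp] theorem coe_ptA (a : R.A) : (R.ptA a : M) = (a.1.1 : M) := rfl

/-- `ptA` is smooth. [folklore] -/
theorem contMDiff_ptA : ContMDiff (𝓡∂ (m + 2)) (𝓡 (m + 1)) ∞ R.ptA :=
  R.contMDiff_toPunct.comp (contMDiff_fst.comp R.contMDiff_val_A)

/-- **The inverse map on the first piece**: `(x, s) ↦ [x]₁` near the face `s = 0` and
`(x, s) ↦ [x]₂` near the face `s = 1` (only its values on the two faces matter). [folklore] -/
def lamA (a : R.A) : R.P₀ := if a.1.2 ≤ 2⁻¹ then R.inlP (R.ptA a) else R.inrP (R.ptA a)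

omit [IsManifold (𝓡 (m + 1)) ∞ M] in
/-- Near the face `s = 0` (`s ≤ ½`) the inverse map is `[·]₁ ∘ ptA`. [folklore] -/
theorem lamA_of_le {a : R.A} (h : a.1.2 ≤ 2⁻¹) : R.lamA a = R.inlP (R.ptA a) := if_pos h

omit [IsManifold (𝓡 (m + 1)) ∞ M] in
/-- Near the face `s = 1` (`s > ½`) the inverse map is `[·]₂ ∘ ptA`. [folklore] -/
theorem lamA_of_lt {a : R.A} (h : 2⁻¹ < a.1.2) : R.lamA a = R.inrP (R.ptA a) := if_neg (not_le.2 h)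

omit [T2Space M] [IsManifold (𝓡 (m + 1)) ∞ M] in
/-- A coordinate of a vector of `ℝ²` is bounded by the norm. [folklore] -/
theorem _root_.Literature.Topology.FourManifolds.RotationBody.abs_apply_one_le_norm (z : 𝔼 2) : |z 1| ≤ ‖z‖ := by
  rw [RotationBody.norm_two, ← Real.sqrt_sq_eq_abs]
  exact Real.sqrt_le_sqrt (by nlinarith [sq_nonneg (z 0)])

omit [T2Space M] [IsManifold (𝓡 (m + 1)) ∞ M] in
/-- The coefficient `(1 + z₁)/2` of the inverse map lies in `(0, 1)`. [folklore] -/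
theorem _root_.Literature.Topology.FourManifolds.RotationBody.lamCoeff_mem (b : B m) :
    (1 + (b.1.2 : 𝔼 2) 1) / 2 ∈ Ioo (0 : ℝ) 1 := by
  have h := abs_apply_one_le_norm (b.1.2 : 𝔼 2)
  have h1 := B_norm_lt b
  rw [abs_le] at h
  constructor
  · linarith [h.1]
  · linarith [h.2]

/-- The vector `((1 + z₁)/2) w` of the inverse map on the second piece. [folklore] -/
def _root_.Literature.Topology.FourManifolds.RotationBody.lamVec (b : B m) : 𝔼 (m + 1) :=
  ((1 + (b.1.2 : 𝔼 2) 1) / 2) • (b.1.1 : 𝔼 (m + 1))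

omit [T2Space M] [IsManifold (𝓡 (m + 1)) ∞ M] in
/-- `‖lamVec (w, z)‖ = (1 + z₁)/2`. [folklore] -/
theorem _root_.Literature.Topology.FourManifolds.RotationBody.norm_lamVec (b : B m) : ‖lamVec b‖ = (1 + (b.1.2 : 𝔼 2) 1) / 2 := by
  rw [lamVec, norm_smul, Real.norm_eq_abs, abs_of_pos (lamCoeff_mem b).1,
    mem_sphere_zero_iff_norm.1 b.1.1.2, mul_one]

omit [T2Space M] [IsManifold (𝓡 (m + 1)) ∞ M] in
/-- `‖lamVec b‖ ∈ (0, 1)`. [folklore] -/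
theorem _root_.Literature.Topology.FourManifolds.RotationBody.norm_lamVec_mem (b : B m) : ‖lamVec b‖ ∈ Ioo (0 : ℝ) 1 := by
  rw [norm_lamVec]; exact lamCoeff_mem b

omit [T2Space M] [IsManifold (𝓡 (m + 1)) ∞ M] in
/-- `lamVec b ≠ 0`. [folklore] -/
theorem _root_.Literature.Topology.FourManifolds.RotationBody.lamVec_ne_zero (b : B m) : lamVec b ≠ 0 :=
  norm_pos_iff.1 (norm_lamVec_mem b).1

omit [T2Space M] [IsManifold (𝓡 (m + 1)) ∞ M] in
/-- The normalisation of `lamVec (w, z)` is `w`. [folklore] -/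
theorem _root_.Literature.Topology.FourManifolds.RotationBody.sphN_lamVec (b : B m) : sphN (lamVec b) = b.1.1 := by
  rw [lamVec, sphN_smul (lamCoeff_mem b).1 (B_fst_ne_zero b), sphN_coe]

omit [IsManifold (𝓡 (m + 1)) ∞ M] in
/-- `i v ∈ M ∖ {i 0}` for `v ≠ 0`. [folklore] -/
theorem i_mem_Mpunct {v : 𝔼 (m + 1)} (hv : v ≠ 0) : R.i v ∈ R.Mpunct := fun h =>
  hv (R.i_injective h)

/-- The point `i(((1 + z₁)/2) w)` of `M ∖ {i 0}` under a point `(w, z)` of the second piece.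
[folklore] -/
def ptB (b : B m) : ↥R.Mpunct := ⟨R.i (lamVec b), R.i_mem_Mpunct (lamVec_ne_zero b)⟩

omit [IsManifold (𝓡 (m + 1)) ∞ M] in
/-- The underlying point of `ptB b` is `i (lamVec b)`. [folklore] -/
@[simp] theorem coe_ptB (b : B m) : (R.ptB b : M) = R.i (lamVec b) := rfl

/-- **The inverse map on the second piece**: `(w, z) ↦ [i(((1 + z₁)/2) w)]₁`. On the diameter,
`z = (0, b)` with `b = 2t - 1`, this is `[i(t w)]₁ = [i((1 - t) w)]₂`, matching both faces.
[cite: KervaireMilnorAnnals1963, Lemma 2.4, proof (p. 507)] -/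
def lamB (b : B m) : R.P₀ := R.inlP (R.ptB b)

omit [T2Space M] [IsManifold (𝓡 (m + 1)) ∞ M] in
/-- `lamVec` is smooth. [folklore] -/
theorem _root_.Literature.Topology.FourManifolds.RotationBody.contMDiff_lamVec :
    ContMDiff (𝓡∂ (m + 2)) 𝓘(ℝ, 𝔼 (m + 1)) ∞ (lamVec : B m → 𝔼 (m + 1)) := by
  have hF : ContDiff ℝ ∞ (fun q : 𝔼 (m + 1) × 𝔼 2 => ((1 + q.2 1) / 2) • q.1) := by
    have h1 : ContDiff ℝ ∞ (fun z : 𝔼 2 => z 1) :=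
      (EuclideanSpace.proj (1 : Fin 2) : 𝔼 2 →L[ℝ] ℝ).contDiff
    exact ((contDiff_const.add (h1.comp contDiff_snd)).div_const _).smul contDiff_fst
  exact hF.comp_contMDiff contMDiff_B_pair

omit [IsManifold (𝓡 (m + 1)) ∞ M] in
/-- `ptB` is smooth. [folklore] -/
theorem contMDiff_ptB : ContMDiff (𝓡∂ (m + 2)) (𝓡 (m + 1)) ∞ R.ptB := by
  rw [← ContMDiff.subtypeVal_comp_iff]
  exact R.contMDiff_i.comp contMDiff_lamVec

/-- `lamB` is smooth. [folklore] -/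
theorem contMDiff_lamB : ContMDiff (𝓡∂ (m + 2)) (𝓡 (m + 1)) ∞ R.lamB :=
  (R.csd.glueData hn).contMDiff_inl.comp R.contMDiff_ptB

/-- `lamA` is smooth at points near the face `s = 0` (there it is `[·]₁ ∘ ptA`). [folklore] -/
theorem contMDiffAt_lamA_of_lt {a : R.A} (ha : a.1.2 < 2⁻¹) :
    ContMDiffAt (𝓡∂ (m + 2)) (𝓡 (m + 1)) ∞ R.lamA a := by
  have hO : IsOpen {a : R.A | a.1.2 < 2⁻¹} := isOpen_Iio.preimage R.contMDiff_A_snd.continuous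
  have h : ContMDiffOn (𝓡∂ (m + 2)) (𝓡 (m + 1)) ∞ (fun a => R.inlP (R.ptA a)) {a : R.A | a.1.2 < 2⁻¹} :=
    ((R.csd.glueData hn).contMDiff_inl.comp R.contMDiff_ptA).contMDiffOn
  exact (h.congr fun a' ha' => R.lamA_of_le (le_of_lt ha')).contMDiffAt (hO.mem_nhds ha)

/-- `lamA` is smooth at points near the face `s = 1` (there it is `[·]₂ ∘ ptA`). [folklore] -/
theorem contMDiffAt_lamA_of_gt {a : R.A} (ha : 2⁻¹ < a.1.2) :
    ContMDiffAt (𝓡∂ (m + 2)) (𝓡 (m + 1)) ∞ R.lamA a := by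
  have hO : IsOpen {a : R.A | 2⁻¹ < a.1.2} := isOpen_Ioi.preimage R.contMDiff_A_snd.continuous
  have h : ContMDiffOn (𝓡∂ (m + 2)) (𝓡 (m + 1)) ∞ (fun a => R.inrP (R.ptA a)) {a : R.A | 2⁻¹ < a.1.2} :=
    ((R.csd.glueData hn).contMDiff_inr.comp R.contMDiff_ptA).contMDiffOn
  exact (h.congr fun a' ha' => R.lamA_of_lt ha').contMDiffAt (hO.mem_nhds ha)

/-- `lamA` is smooth at every point of the two faces. [folklore] -/
theorem contMDiffAt_lamA_of_face {a : R.A} (ha : a.1.2 = 0 ∨ a.1.2 = 1) :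
    ContMDiffAt (𝓡∂ (m + 2)) (𝓡 (m + 1)) ∞ R.lamA a := by
  rcases ha with h | h
  · exact R.contMDiffAt_lamA_of_lt (by rw [h]; norm_num)
  · exact R.contMDiffAt_lamA_of_gt (by rw [h]; norm_num)

omit [IsManifold (𝓡 (m + 1)) ∞ M] in
/-- **Compatibility of the two inverse maps along the gluing of `W`, on the faces**: for
`a = (i v, s)` with `½ < ‖v‖ < 1` and `s ∈ {0, 1}`, `lamA a = lamB (ψ a)`. For `s = 0` both are
`[i v]₁`; for `s = 1`, `lamA a = [i v]₂` and `lamB (ψ a) = [i((1 - ‖v‖) v/‖v‖)]₁`, which agree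
by the connected sum identification. [cite: KervaireMilnorAnnals1963, Lemma 2.4, proof (p. 507)] -/
theorem lamA_eq_lamB {a : R.A} (ha : a ∈ R.glueSource) (hs : a.1.2 = 0 ∨ a.1.2 = 1) :
    R.lamA a = R.lamB (R.glueFun a) := by
  have h0 : 0 < ‖R.e a.1.1‖ := R.norm_pos_of_mem_glueSource ha
  have hv0 : R.e a.1.1 ≠ 0 := norm_pos_iff.1 h0
  have h1 : ‖R.e a.1.1‖ < 1 := ha.2
  have hxv : (a.1.1 : M) = R.i (R.e a.1.1) := (R.i_e ha.1).symm
  have hu : ‖(sphN (R.e a.1.1) : 𝔼 (m + 1))‖ = 1 := mem_sphere_zero_iff_norm.1 (sphN _).2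
  have hlam : lamVec (R.glueFun a) =
      ((1 + (2 * ‖R.e a.1.1‖ - 1) * Real.cos (π * a.1.2)) / 2) • (sphN (R.e a.1.1) : 𝔼 (m + 1)) := by
    rw [lamVec, glueFun_coe_snd, glueFun_coe_fst, R.glueVec_of_mem ha, PiLp.smul_apply, smul_eq_mul,
      rot_apply_one]
    rfl
  rw [lamB]
  rcases hs with hs0 | hs1
  · -- face `s = 0`: both sides are `[x]₁`
    rw [R.lamA_of_le (by rw [hs0]; norm_num)]
    congr 1
    apply Subtype.ext
    rw [coe_ptA, coe_ptB, hlam, hs0, mul_zero, Real.cos_zero, mul_one]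
    have : (1 + (2 * ‖R.e a.1.1‖ - 1)) / 2 = ‖R.e a.1.1‖ := by ring
    rw [this, norm_smul_coe_sphN hv0, ← hxv]
  · -- face `s = 1`: `[x]₂ = [i((1 - ‖v‖) u)]₁` by the connected sum identification
    rw [R.lamA_of_lt (by rw [hs1]; norm_num)]
    have ht : 1 - ‖R.e a.1.1‖ ∈ Ioo (0 : ℝ) 1 := ⟨by linarith, by linarith⟩
    have hcoef : (1 + (2 * ‖R.e a.1.1‖ - 1) * Real.cos (π * a.1.2)) / 2 = 1 - ‖R.e a.1.1‖ := by
      rw [hs1, mul_one, Real.cos_pi]; ring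
    have hw0 : (sphN (R.e a.1.1) : 𝔼 (m + 1)) ≠ 0 := fun h => by
      rw [h, norm_zero] at hu; exact zero_ne_one hu
    have hb : R.i ((1 - ‖R.e a.1.1‖) • (sphN (R.e a.1.1) : 𝔼 (m + 1))) ∈ R.Mpunct :=
      R.i_mem_Mpunct (smul_ne_zero ht.1.ne' hw0)
    have hxeq : (a.1.1 : M) = R.i ((1 - (1 - ‖R.e a.1.1‖)) • (sphN (R.e a.1.1) : 𝔼 (m + 1))) := by
      rw [sub_sub_cancel, norm_smul_coe_sphN hv0, ← hxv]
    have ha' : R.i ((1 - (1 - ‖R.e a.1.1‖)) • (sphN (R.e a.1.1) : 𝔼 (m + 1))) ∈ R.Mpunct := by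
      rw [← hxeq]; exact R.M'_le_Mpunct a.1.1.2
    have e1 : R.ptB (R.glueFun a) = ⟨_, hb⟩ := Subtype.ext (by rw [coe_ptB, hlam, hcoef])
    have e2 : R.ptA a = ⟨_, ha'⟩ := Subtype.ext hxeq
    rw [e1, e2]
    exact (R.inlP_eq_inrP hu ht hb ha').symm

/-- **The inverse map `W → P₀`** (only its restriction to `∂W` matters): `lamA` through `inl` and
`lamB` through `inr`, the former taking precedence on the overlap. [folklore] -/
def ofW (w : R.W) : R.P₀ :=
  if h : ∃ a, R.glueData.inl a = w then R.lamA h.choose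
  else R.lamB ((R.glueData.exists_inl_or_inr w).resolve_left h).choose

/-- The companion of `ofW` in which `lamB` takes precedence (used to see smoothness near points
of the second piece). [folklore] -/
def ofW' (w : R.W) : R.P₀ :=
  if h : ∃ b, R.glueData.inr b = w then R.lamB h.choose
  else R.lamA ((R.glueData.exists_inl_or_inr w).resolve_right h).choose

/-- The inverse map on the first piece is `lamA`. [folklore] -/
theorem ofW_inl (a : R.A) : R.ofW (R.glueData.inl a) = R.lamA a := by
  have h : ∃ a', R.glueData.inl a' = R.glueData.inl a := ⟨a, rfl⟩
  rw [ofW, dif_pos h, R.glueData.inl_injective h.choose_spec]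

/-- The auxiliary inverse map on the second piece is `lamB`. [folklore] -/
theorem ofW'_inr (b : B m) : R.ofW' (R.glueData.inr b) = R.lamB b := by
  have h : ∃ b', R.glueData.inr b' = R.glueData.inr b := ⟨b, rfl⟩
  rw [ofW', dif_pos h, R.glueData.inr_injective h.choose_spec]

/-- On boundary points of the second piece, `ofW` is `lamB` (by the face compatibility
`lamA_eq_lamB`). [folklore] -/
theorem ofW_inr {b : B m} (hb : R.glueData.inr b ∈ (𝓡∂ (m + 2)).boundary R.W) :
    R.ofW (R.glueData.inr b) = R.lamB b := by
  by_cases h : ∃ a, R.glueData.inl a = R.glueData.inr b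
  · rw [ofW, dif_pos h]
    obtain ⟨ha, hab⟩ := R.glueData.inl_eq_inr_iff.1 h.choose_spec
    have hbd : h.choose.1.2 = 0 ∨ h.choose.1.2 = 1 := by
      rw [← R.isBoundaryPoint_inl_iff, h.choose_spec]; exact hb
    rw [R.lamA_eq_lamB ha hbd, ← glue_apply, ← glueData_glue, hab]
  · have h' := (R.glueData.exists_inl_or_inr (R.glueData.inr b)).resolve_left h
    rw [ofW, dif_neg h, R.glueData.inr_injective h'.choose_spec]

/-- On boundary points, `ofW' = ofW`. [folklore] -/
theorem ofW'_eq_ofW {w : R.W} (hw : w ∈ (𝓡∂ (m + 2)).boundary R.W) : R.ofW' w = R.ofW w := by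
  obtain ⟨a, rfl⟩ | ⟨b, rfl⟩ := R.glueData.exists_inl_or_inr w
  · by_cases h : ∃ b, R.glueData.inr b = R.glueData.inl a
    · obtain ⟨b, hb⟩ := h
      rw [← hb] at hw ⊢
      rw [R.ofW'_inr, R.ofW_inr hw]
    · have h' := (R.glueData.exists_inl_or_inr (R.glueData.inl a)).resolve_right h
      rw [ofW', dif_neg h, R.ofW_inl, R.glueData.inl_injective h'.choose_spec]
  · rw [R.ofW'_inr, R.ofW_inr hw]

/-- **The inverse map `∂W → P₀`.** [cite: KervaireMilnorAnnals1963, Lemma 2.4, proof (p. 507)] -/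
def ofBoundary (p : R.bdW) : R.P₀ := R.ofW p.1

/-- `ofBoundary` is `ofW` on underlying points (definitional). [folklore] -/
theorem ofBoundary_apply (p : R.bdW) : R.ofBoundary p = R.ofW p.1 := rfl

/-! #### The two maps are mutually inverse -/

omit [T2Space M] [IsManifold (𝓡 (m + 1)) ∞ M] in
/-- `lamVec (diamB s v)`: the inverse map on a diameter point coming from `i v`. [folklore] -/
theorem _root_.Literature.Topology.FourManifolds.RotationBody.lamVec_diamB {s : ℝ} (hs : s = 0 ∨ s = 1) {v : 𝔼 (m + 1)} (hv : 0 < ‖v‖ ∧ ‖v‖ < 1) :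
    lamVec (diamB s hs v) = ((1 + (2 * ‖v‖ - 1) * Real.cos (π * s)) / 2) • (sphN v : 𝔼 (m + 1)) := by
  rw [lamVec, diamB_coe_snd, diamB_coe_fst, dV_of_mem hv, PiLp.smul_apply, smul_eq_mul, rot_apply_one]

/-- `ofW ∘ toW = id` on the first copy. [folklore] -/
theorem ofW_toW_inlP (a : ↥R.Mpunct) : R.ofW (R.toW (R.inlP a)) = R.inlP a := by
  rw [toW_inlP]
  by_cases hd : a ∈ R.discSet
  · have hv := R.norm_mem_of_mem_discSet hd
    have hv0 : R.e a ≠ 0 := norm_pos_iff.1 hv.1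
    rw [R.bdryMap_of_mem_discSet hd, R.ofW_inr (R.bdryMap_of_mem_discSet hd ▸
      R.bdryMap_mem_boundary face_zero a), lamB]
    congr 1
    apply Subtype.ext
    rw [coe_ptB, lamVec_diamB face_zero hv, mul_zero, Real.cos_zero, mul_one]
    have : (1 + (2 * ‖R.e a‖ - 1)) / 2 = ‖R.e a‖ := by ring
    rw [this, norm_smul_coe_sphN hv0, R.i_e hd.1]
  · have hM := R.mem_M'_of_not_mem_discSet hd
    rw [R.bdryMap_of_mem_M' hM, R.ofW_inl, R.lamA_of_le (by show (0 : ℝ) ≤ 2⁻¹; norm_num)]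
    congr 1

/-- `ofW ∘ toW = id` on the second copy (here the connected-sum identification `[i(tu)]₁ = [i((1 - t)u)]₂` is used). [folklore] -/
theorem ofW_toW_inrP (b : ↥R.Mpunct) : R.ofW (R.toW (R.inrP b)) = R.inrP b := by
  rw [toW_inrP]
  by_cases hd : b ∈ R.discSet
  · have hv := R.norm_mem_of_mem_discSet hd
    set v := R.e b with hvdef
    have hv0 : v ≠ 0 := norm_pos_iff.1 hv.1
    rw [R.bdryMap_of_mem_discSet hd, R.ofW_inr (R.bdryMap_of_mem_discSet hd ▸
      R.bdryMap_mem_boundary face_one b), lamB]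
    have hu : ‖(sphN v : 𝔼 (m + 1))‖ = 1 := mem_sphere_zero_iff_norm.1 (sphN v).2
    have ht : 1 - ‖v‖ ∈ Ioo (0 : ℝ) 1 := ⟨by linarith [hv.2], by linarith [hv.1]⟩
    have hcoef : (1 + (2 * ‖v‖ - 1) * Real.cos (π * 1)) / 2 = 1 - ‖v‖ := by
      rw [mul_one, Real.cos_pi]; ring
    have hw0 : (sphN v : 𝔼 (m + 1)) ≠ 0 := fun h => by rw [h, norm_zero] at hu; exact zero_ne_one hu
    have hb1 : R.i ((1 - ‖v‖) • (sphN v : 𝔼 (m + 1))) ∈ R.Mpunct :=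
      R.i_mem_Mpunct (smul_ne_zero ht.1.ne' hw0)
    have hxeq : (b : M) = R.i ((1 - (1 - ‖v‖)) • (sphN v : 𝔼 (m + 1))) := by
      rw [sub_sub_cancel, norm_smul_coe_sphN hv0, hvdef, R.i_e hd.1]
    have hb2 : R.i ((1 - (1 - ‖v‖)) • (sphN v : 𝔼 (m + 1))) ∈ R.Mpunct := hxeq ▸ b.2
    have e1 : R.ptB (diamB 1 face_one v) = ⟨R.i ((1 - ‖v‖) • (sphN v : 𝔼 (m + 1))), hb1⟩ :=
      Subtype.ext (by rw [coe_ptB, lamVec_diamB face_one hv, hcoef])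
    have e2 : b = ⟨R.i ((1 - (1 - ‖v‖)) • (sphN v : 𝔼 (m + 1))), hb2⟩ := Subtype.ext hxeq
    rw [e1, R.inlP_eq_inrP hu ht hb1 hb2, ← e2]
  · have hM := R.mem_M'_of_not_mem_discSet hd
    rw [R.bdryMap_of_mem_M' hM, R.ofW_inl, R.lamA_of_lt (by show (2⁻¹ : ℝ) < 1; norm_num)]
    congr 1

/-- `ofBoundary ∘ toBoundary = id`. [folklore] -/
theorem ofBoundary_toBoundary (p : R.P₀) : R.ofBoundary (R.toBoundary p) = p := by
  rw [ofBoundary_apply, coe_toBoundary]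
  obtain ⟨a, rfl⟩ | ⟨b, rfl⟩ := (R.csd.glueData hn).exists_inl_or_inr p
  · exact R.ofW_toW_inlP a
  · exact R.ofW_toW_inrP b

/-- `toW (ofW (inl a)) = inl a` for a face point `a`. [folklore] -/
theorem toW_ofW_inl {a : R.A} (ha : a.1.2 = 0 ∨ a.1.2 = 1) : R.toW (R.ofW (R.glueData.inl a)) = R.glueData.inl a := by
  rw [R.ofW_inl]
  rcases ha with h0 | h1
  · rw [R.lamA_of_le (by rw [h0]; norm_num), toW_inlP, R.bdryMap_of_mem_M' (a := R.ptA a) a.1.1.2]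
    congr 1
    apply Subtype.ext
    rw [mkA_coe]
    exact Prod.ext (Subtype.ext rfl) h0.symm
  · rw [R.lamA_of_lt (by rw [h1]; norm_num), toW_inrP, R.bdryMap_of_mem_M' (a := R.ptA a) a.1.1.2]
    congr 1
    apply Subtype.ext
    rw [mkA_coe]
    exact Prod.ext (Subtype.ext rfl) h1.symm

omit [T2Space M] [IsManifold (𝓡 (m + 1)) ∞ M] in
/-- `diamB 0 (lamVec b) = b` for a diameter point `b` (`z₀ = 0`). [folklore] -/
theorem _root_.Literature.Topology.FourManifolds.RotationBody.diamB_lamVec {b : B m} (hb : (b.1.2 : 𝔼 2) 0 = 0) : diamB 0 face_zero (lamVec b) = b := by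
  have hv := norm_lamVec_mem b
  apply Subtype.ext
  apply Prod.ext
  · rw [diamB_coe_fst, sphN_lamVec]
  · apply Subtype.ext
    rw [diamB_coe_snd, dV_of_mem hv, norm_lamVec, rot_zero]
    have : 2 * ((1 + (b.1.2 : 𝔼 2) 1) / 2) - 1 = (b.1.2 : 𝔼 2) 1 := by ring
    rw [this]
    conv_rhs => rw [← E2_eta (b.1.2 : 𝔼 2), hb]
    ext j
    fin_cases j <;> simp [E2]

/-- `toW (ofW (inr b)) = inr b` for a diameter point `b`. [folklore] -/
theorem toW_ofW_inr {b : B m} (hb : R.glueData.inr b ∈ (𝓡∂ (m + 2)).boundary R.W) :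
    R.toW (R.ofW (R.glueData.inr b)) = R.glueData.inr b := by
  have hb0 : (b.1.2 : 𝔼 2) 0 = 0 := (R.isBoundaryPoint_inr_iff b).1 hb
  rw [R.ofW_inr hb, lamB, toW_inlP]
  have hd : R.ptB b ∈ R.discSet := by
    refine ⟨R.i_mem _, ?_⟩
    show ‖R.e (R.i (lamVec b))‖ < 1
    rw [R.e_i]; exact (norm_lamVec_mem b).2
  rw [R.bdryMap_of_mem_discSet hd]
  congr 1
  show diamB 0 face_zero (R.e (R.i (lamVec b))) = b
  rw [R.e_i, diamB_lamVec hb0]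

/-- `toBoundary ∘ ofBoundary = id`. [folklore] -/
theorem toBoundary_ofBoundary (p : R.bdW) : R.toBoundary (R.ofBoundary p) = p := by
  apply Subtype.ext
  rw [coe_toBoundary, ofBoundary_apply]
  obtain ⟨a, ha⟩ | ⟨b, hb⟩ := R.glueData.exists_inl_or_inr p.1
  · have hbd : a.1.2 = 0 ∨ a.1.2 = 1 := by rw [← R.isBoundaryPoint_inl_iff, ha]; exact p.2
    rw [← ha, R.toW_ofW_inl hbd]
  · have hb' : R.glueData.inr b ∈ (𝓡∂ (m + 2)).boundary R.W := by rw [hb]; exact p.2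
    rw [← hb, R.toW_ofW_inr hb']

/-! #### Smoothness of the inverse map -/

/-- The inclusion `∂W → W` is smooth. [folklore] -/
theorem contMDiff_bdW_val : ContMDiff (𝓡 (m + 1)) (𝓡∂ (m + 2)) ∞ (Subtype.val : R.bdW → R.W) :=
  (BoundaryManifold.isSmoothEmbedding_subtype_val (n := m + 1) (W := R.W)).contMDiff

/-- `ofW` is smooth at the face points of the first piece (descent along `inl`). [folklore] -/
theorem contMDiffAt_ofW_inl {a : R.A} (ha : a.1.2 = 0 ∨ a.1.2 = 1) :
    ContMDiffAt (𝓡∂ (m + 2)) (𝓡 (m + 1)) ∞ R.ofW (R.glueData.inl a) :=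
  contMDiffAt_of_comp_isImmersionAt (R.glueData.isSmoothEmbedding_inlH.isImmersion.isImmersionAt a)
    R.glueData.isOpenMap_inl (R.contMDiffAt_lamA_of_face ha) R.ofW_inl

/-- `ofW'` is smooth at the points of the second piece (descent along `inr`). [folklore] -/
theorem contMDiffAt_ofW'_inr (b : B m) :
    ContMDiffAt (𝓡∂ (m + 2)) (𝓡 (m + 1)) ∞ R.ofW' (R.glueData.inr b) :=
  contMDiffAt_of_comp_isImmersionAt (R.glueData.isSmoothEmbedding_inrH.isImmersion.isImmersionAt b)
    R.glueData.isOpenMap_inr (R.contMDiff_lamB b) R.ofW'_inr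

/-- **The inverse map `∂W → P₀` is smooth.** Near a face point it is `ofW ∘ val` with `ofW`
smooth there; near a diameter point it agrees with `ofW' ∘ val` (`ofW' = ofW` on `∂W`) with
`ofW'` smooth there. [folklore] -/
theorem contMDiff_ofBoundary : ContMDiff (𝓡 (m + 1)) (𝓡 (m + 1)) ∞ R.ofBoundary := by
  intro p
  obtain ⟨a, ha⟩ | ⟨b, hb⟩ := R.glueData.exists_inl_or_inr p.1
  · have hbd : a.1.2 = 0 ∨ a.1.2 = 1 := by rw [← R.isBoundaryPoint_inl_iff, ha]; exact p.2
    have h := R.contMDiffAt_ofW_inl hbd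
    rw [ha] at h
    exact h.comp p (R.contMDiff_bdW_val p)
  · have h := R.contMDiffAt_ofW'_inr b
    rw [hb] at h
    have h2 : ContMDiffAt (𝓡 (m + 1)) (𝓡 (m + 1)) ∞ (R.ofW' ∘ Subtype.val) p :=
      h.comp p (R.contMDiff_bdW_val p)
    refine h2.congr_of_eventuallyEq (Filter.Eventually.of_forall fun q => ?_)
    exact (R.ofW'_eq_ofW q.2).symm

/-! ### The diffeomorphism `P₀ ≅ ∂W` and the null-cobordism of `M # (-M)` -/

/-- The bijection `P₀ ≃ ∂W`. [folklore] -/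
def boundaryEquiv : R.P₀ ≃ R.bdW :=
  ⟨R.toBoundary, R.ofBoundary, R.ofBoundary_toBoundary, R.toBoundary_ofBoundary⟩

/-- **`M # (-M) ≅ ∂W`**: the double of `M` along the disc `i` is diffeomorphic to the boundary of
the rotation body (Kervaire–Milnor 1963, proof of Lemma 2.4: "`bW = M # (-M)`").
[cite: KervaireMilnorAnnals1963, Lemma 2.4, proof (p. 507)] -/
def boundaryDiffeo : R.P₀ ≃ₘ⟮𝓡 (m + 1), 𝓡 (m + 1)⟯ R.bdW where
  toEquiv := R.boundaryEquiv
  contMDiff_toFun := R.contMDiff_toBoundary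
  contMDiff_invFun := R.contMDiff_ofBoundary

/-- `boundaryDiffeo` is `toBoundary` as a function (definitional). [folklore] -/
@[simp] theorem boundaryDiffeo_apply (p : R.P₀) : R.boundaryDiffeo p = R.toBoundary p := rfl

variable [CompactSpace M]

/-- The rotation body as a null-cobordism of its own boundary `∂W`. [folklore] -/
def bdryNullCobordism : NullCobordism (m + 1) R.bdW where
  W := R.W
  incl := Subtype.val
  isSmoothEmbedding_incl := BoundaryManifold.isSmoothEmbedding_subtype_val
  range_incl := Subtype.range_coe

/-- **`M # (-M)` bounds the rotation body**: the null-cobordism `P₀ = ∂W` of the double of `M`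
along `i`, with total space `W` (Kervaire–Milnor 1963, Lemma 2.4: "`M # (-M)` bounds" `W`).
[cite: KervaireMilnorAnnals1963, Lemma 2.4, proof (p. 507)] -/
def nullCobordism : NullCobordism (m + 1) R.P₀ := R.bdryNullCobordism.comap R.boundaryDiffeo

/-- The total space of the null-cobordism of `M # (-M)` is the rotation body `W`. [folklore] -/
theorem nullCobordism_W : R.nullCobordism.W = R.W := rfl

/-- The boundary inclusion of the null-cobordism of `M # (-M)` is `toW`. [folklore] -/
theorem nullCobordism_incl (p : R.P₀) : R.nullCobordism.incl p = R.toW p := rfl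

end RotationData

end Literature.Topology.FourManifolds
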